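import Summits.QuantumAdvantage.QuantumAdvantage.Theses.ArithStatLadder
import Summits.QuantumAdvantage.QuantumAdvantage.Theorems.ArithStatLadderIqThreeNotPPoly
import Summits.QuantumAdvantage.QuantumAdvantage.Theorems.ArithStatLadderIqThreeNotPPolyStubOneSidedNagell
import Summits.QuantumAdvantage.QuantumAdvantage.Theorems.ArithStatLadderIqThreeNotPPolyStubSqfreeProductNagell
import Summits.QuantumAdvantage.QuantumAdvantage.Theorems.ArithStatLadderIqThreeNotPPolyStubDensityNagell
import Summits.QuantumAdvantage.QuantumAdvantage.Theorems.ArithStatLadderIqThreeNotPPolyStubNagellData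
import Summits.QuantumAdvantage.QuantumAdvantage.Theorems.ArithStatLadderIqThreeNotPPolyStubNagellThreeTorsion
import Summits.QuantumAdvantage.QuantumAdvantage.Theorems.ArithStatLadderIqThreeNotPPolyStubSamplerNagellFP

/-!
# Crux `ArithStatLadder.IqThreeNotPPoly` (stmt-QuantumAdvantage-2422): SQUAREFREE-FILTER DOMINATION, unconditionally — the 6-free-core Nagell sampler

The conclusion of the line `Sketch`, skeleton v4 "NAGELL PLANTING" of the continuation lead
`prover-line-stmt-QuantumAdvantage-2422-c1-0` (skeleton `Cruxes/IqThreeNotPPoly/Lines/Sketch.lean`).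
The v3 conclusion (`ArithStatLadderIqThreeNotPPoly.lean`) proved `IQ3 ∈ P/poly → SQUAREFREES ∈ P/poly`
modulo Hasse's class-field-theoretic dictionary (a named fact); the gen-1 lead's conclusion
(`ArithStatLadderIqThreeNotPPolyNagell.lean`, sampler `N s (4c³ − N s)`) removed that hypothesis via
Nagell's elementary 3-torsion. This file is the SECOND, INDEPENDENT unconditional reduction, through
the 6-free-core sampler and the abstract Nagell lemma `stub_nagellThreeTorsion`
(`∀ a y d, 1 < a → 4a < d → d squarefree → y odd → y² + d = 4a³ → 3 ∣ h(−d)`): the planted cubic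
field of v3 is replaced by a planted norm equation `y² + d = 4a³`, whose order-`3` ideal class
`(a, (y + √−d)/2)` in `ℚ(√−d)` is explicit and elementary (Nagell 1922).

* `toLanguage_squarefree_mem_PPoly_of_iqThree_nagell` — **`IQ3 ∈ P/poly → SQUAREFREES ∈ P/poly`**,
  UNCONDITIONAL: a one-sided randomized polynomial-time reduction `SQF ≤ IQ3` with success `≥ 1/4`
  (sampler `stub_samplerNagellFP`, guard `stub_natAdapter`, exact NO side `stub_oneSidedNagell`,
  YES-density `stub_densityNagell ∘ stub_sqfreeProductNagell ∘ stub_apSieve`, hits certified by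
  `stub_nagellData` + `stub_nagellThreeTorsion`), fed to the landed closure of `P/poly` under such
  reductions (`mem_PPoly_of_rurReduction`, Adleman's hard-wired hitting seeds);
* the crux-level corollaries — `SQUAREFREES ∉ P/poly → IqThreeNotPPoly` (the crux from the
  hypothesis-type apex alone) and the refutation floor `¬IqThreeNotPPoly → SQUAREFREES ∈ P/poly` —
  are one-liners from the previous theorem and are NOT restated here: they are already in the tree as
  `iqThreeNotPPoly_of_sqfreeNotPPoly` / `sqfree_mem_PPoly_of_not_iqThreeNotPPoly`
  (`ArithStatLadderIqThreeNotPPolyNagell.lean`, the gen-1 lead's twin reduction).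

The sampler: on a numeral `x = bin N` and a seed `r`, `j = ⟦r⟧`, put `G = N / gcd(N, 6)`,
`t = 1 + 11G + 11G² + 30Gj` and output `bin (G t (G t + 8)(4 G t + 27))`; note
`G t (Gt+8)(4Gt+27) = 4k³ − (7k − 9)²` with `k = 9 + Gt`. NO side: `N` not squarefree ⇒ `G` has a
square prime factor or `2 ∣ G` or `3 ∣ G` (`core_bad`) ⇒ never fundamental. YES side: `N` squarefree
⇒ `G` squarefree, odd, prime to `3` (`core_facts`) ⇒ `≥ 1/4` of the seeds give a squarefree, hence
fundamental, output carrying Nagell data, hence `3 ∣ h(−d)`.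
-/

set_option linter.dupNamespace false -- D-0017: single-problem summit ⇒ `QuantumAdvantage.QuantumAdvantage` by design

noncomputable section

namespace Summit.QuantumAdvantage.QuantumAdvantage.Theorems.IqThreeNotPPoly

open scoped Classical
open _root_.Computability Literature.Computability.Complexity
open Literature.Computability.Cryptography (IsNegFundamentalDiscr)
open Literature.NumberTheory.QuadraticFields (BinaryQuadraticForm.classNumber)
open Summit.QuantumAdvantage.QuantumAdvantage.Theses.ArithStatLadder (IqThreeNotPPoly)

/-! ### The `6`-free core of the modulus -/

/-- `G · gcd(N, 6) = N`. [folklore] -/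
theorem sixFreeCore_mul_gcd (N : ℕ) : (N / Nat.gcd N 6) * Nat.gcd N 6 = N :=
  Nat.div_mul_cancel (Nat.gcd_dvd_left N 6)

/-- `G ∣ N`. [folklore] -/
theorem sixFreeCore_dvd (N : ℕ) : (N / Nat.gcd N 6) ∣ N := ⟨Nat.gcd N 6, (sixFreeCore_mul_gcd N).symm⟩

/-- For squarefree `N` the core is squarefree, odd, prime to `3` and positive. [folklore] -/
theorem sixFreeCore_facts {N : ℕ} (hN : Squarefree N) :
    Squarefree ((N / Nat.gcd N 6)) ∧ ¬ 2 ∣ (N / Nat.gcd N 6) ∧ ¬ 3 ∣ (N / Nat.gcd N 6) ∧ 0 < (N / Nat.gcd N 6) := by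
  have hN0 : N ≠ 0 := fun h => by simp [h] at hN
  have hmul := sixFreeCore_mul_gcd N
  have hsqG : Squarefree ((N / Nat.gcd N 6)) := by
    rw [← hmul] at hN
    exact Squarefree.of_mul_left hN
  have hpos : 0 < (N / Nat.gcd N 6) := by
    rcases Nat.eq_zero_or_pos ((N / Nat.gcd N 6)) with h | h
    · rw [h, zero_mul] at hmul; exact absurd hmul.symm hN0
    · exact h
  -- if `p ∈ {2, 3}` divided `G`, then `p ∣ gcd(N,6)` too (as `p ∣ N`, `p ∣ 6`), so `p² ∣ N`
  have key : ∀ p : ℕ, p.Prime → p ∣ 6 → ¬ p ∣ (N / Nat.gcd N 6) := by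
    intro p hp hp6 hpG
    have hpN : p ∣ N := dvd_trans hpG (sixFreeCore_dvd N)
    have hpg : p ∣ Nat.gcd N 6 := Nat.dvd_gcd hpN hp6
    have hp2 : p * p ∣ N := by
      rw [← hmul]; exact mul_dvd_mul hpG hpg
    exact hp.not_isUnit (by simpa using hN p hp2)
  exact ⟨hsqG, key 2 Nat.prime_two (by norm_num), key 3 Nat.prime_three (by norm_num), hpos⟩

/-- For NON-squarefree `N` the core has a square prime factor, or is even, or is divisible by `3`
(`p² ∣ N` with `p ≥ 5` survives in `G`; `9 ∣ N ⇒ 3 ∣ G`; `4 ∣ N ⇒ 2 ∣ G`; `N = 0 ⇒ G = 0`).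
[folklore] -/
theorem sixFreeCore_bad {N : ℕ} (hN : ¬ Squarefree N) :
    (∃ p : ℕ, p.Prime ∧ p ^ 2 ∣ (N / Nat.gcd N 6)) ∨ 2 ∣ (N / Nat.gcd N 6) ∨ 3 ∣ (N / Nat.gcd N 6) := by
  rcases Nat.eq_zero_or_pos N with rfl | hNpos
  · right; left; simp
  obtain ⟨p, hp, hp2⟩ : ∃ p : ℕ, p.Prime ∧ p * p ∣ N := by
    by_contra hcon
    exact hN (Nat.squarefree_iff_prime_squarefree.2 fun p hp h => hcon ⟨p, hp, h⟩)
  have hmul := sixFreeCore_mul_gcd N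
  have hg6 : Nat.gcd N 6 ∣ 6 := Nat.gcd_dvd_right N 6
  by_cases hp6 : p ∣ 6
  · have hp23 : p = 2 ∨ p = 3 := by
      have : p ∣ 2 * 3 := by simpa using hp6
      rcases (Nat.Prime.dvd_mul hp).1 this with h | h
      · left; exact (Nat.prime_dvd_prime_iff_eq hp Nat.prime_two).1 h
      · right; exact (Nat.prime_dvd_prime_iff_eq hp Nat.prime_three).1 h
    have hpp : p * p ∣ (N / Nat.gcd N 6) * Nat.gcd N 6 := by rw [hmul]; exact hp2
    have hpG : p ∣ (N / Nat.gcd N 6) := by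
      by_contra hcon
      have hcop : Nat.Coprime p ((N / Nat.gcd N 6)) := (Nat.Prime.coprime_iff_not_dvd hp).2 hcon
      have h1 : p * p ∣ Nat.gcd N 6 :=
        (Nat.Coprime.dvd_of_dvd_mul_left (Nat.Coprime.mul_left hcop hcop) hpp)
      have h2 : p * p ∣ 6 := dvd_trans h1 hg6
      rcases hp23 with rfl | rfl <;> omega
    rcases hp23 with rfl | rfl
    · right; left; exact hpG
    · right; right; exact hpG
  · left
    refine ⟨p, hp, ?_⟩
    have hcop : Nat.Coprime (p * p) (Nat.gcd N 6) := by
      have hc : Nat.Coprime p (Nat.gcd N 6) :=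
        (Nat.Prime.coprime_iff_not_dvd hp).2 fun h => hp6 (dvd_trans h hg6)
      exact Nat.Coprime.mul_left hc hc
    have : p * p ∣ (N / Nat.gcd N 6) * Nat.gcd N 6 := by rw [hmul]; exact hp2
    rw [sq]
    exact hcop.dvd_of_dvd_mul_right this

/-! ### Seeds, numerals, membership -/

/-- Seeds ↔ numbers for an arbitrary decidability instance on the predicate (`card_filter_seeds`
is stated with the classical one). [folklore] -/
theorem card_filter_seeds_dec (ℓ : ℕ) (P : ℕ → Prop) [DecidablePred P] :
    (Finset.univ.filter (fun r : Fin ℓ → Bool => P (bitsToNat (List.ofFn r)))).card =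
      ((Finset.range (2 ^ ℓ)).filter (fun k => P k)).card := by
  convert card_filter_seeds ℓ P

/-- **A squarefree output of the sampler is in `S`** (`stub_nagellData` + `stub_nagellThreeTorsion`):
`−d` is fundamental and `3 ∣ h(−d)` by Nagell's explicit class of order `3`. -/
theorem nagell_mem_of_squarefree (G j : ℕ)
    (hsq : Squarefree (G * (1 + 11 * G + 11 * G ^ 2 + 30 * G * j) *
      (G * (1 + 11 * G + 11 * G ^ 2 + 30 * G * j) + 8) *
      (4 * (G * (1 + 11 * G + 11 * G ^ 2 + 30 * G * j)) + 27))) :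
    G * (1 + 11 * G + 11 * G ^ 2 + 30 * G * j) *
      (G * (1 + 11 * G + 11 * G ^ 2 + 30 * G * j) + 8) *
      (4 * (G * (1 + 11 * G + 11 * G ^ 2 + 30 * G * j)) + 27) ∈
      {d : ℕ | IsNegFundamentalDiscr d ∧ 3 ∣ BinaryQuadraticForm.classNumber (-(d : ℤ))} := by
  obtain ⟨hfund, a, y, ha, h4a, hyd, hy⟩ := stub_nagellData G j hsq
  exact ⟨hfund, stub_nagellThreeTorsion a y _ ha h4a hsq hy hyd⟩

/-! ### The domination, for any `FP` realisation of the sampler -/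

/-- **`IQ3 ∈ P/poly → SQUAREFREES ∈ P/poly`, given an `FP` realisation of the Nagell sampler.**
The one-sided randomized reduction `SQF ≤ IQ3`: seeds of length `ℓ(n) = 4n + 8`, success
polynomial `16 X + 32`; NO side exact (`stub_oneSidedNagell` on the core, `sixFreeCore_bad`;
non-numerals by the guard `stub_natAdapter`), YES side `≥ 1/4` (`stub_densityNagell` on the core,
`sixFreeCore_facts`, hits in `S` by `nagell_mem_of_squarefree`), closure `mem_PPoly_of_rurReduction`. -/
theorem toLanguage_squarefree_mem_PPoly_of_iqThree_of_sampler
    (hA : ∃ f : List Bool → List Bool, f ∈ FP ∧ ∀ x r : List Bool,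
      f (boolPair x r) = encodeNat
        ((bitsToNat x / Nat.gcd (bitsToNat x) 6) *
          (1 + 11 * (bitsToNat x / Nat.gcd (bitsToNat x) 6) +
            11 * (bitsToNat x / Nat.gcd (bitsToNat x) 6) ^ 2 +
            30 * (bitsToNat x / Nat.gcd (bitsToNat x) 6) * bitsToNat r) *
          ((bitsToNat x / Nat.gcd (bitsToNat x) 6) *
            (1 + 11 * (bitsToNat x / Nat.gcd (bitsToNat x) 6) +
              11 * (bitsToNat x / Nat.gcd (bitsToNat x) 6) ^ 2 +
              30 * (bitsToNat x / Nat.gcd (bitsToNat x) 6) * bitsToNat r) + 8) *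
          (4 * ((bitsToNat x / Nat.gcd (bitsToNat x) 6) *
            (1 + 11 * (bitsToNat x / Nat.gcd (bitsToNat x) 6) +
              11 * (bitsToNat x / Nat.gcd (bitsToNat x) 6) ^ 2 +
              30 * (bitsToNat x / Nat.gcd (bitsToNat x) 6) * bitsToNat r)) + 27)))
    (hIQ : encodingNatBool.toLanguage
      {d : ℕ | IsNegFundamentalDiscr d ∧ 3 ∣ BinaryQuadraticForm.classNumber (-(d : ℤ))} ∈ PPoly) :
    encodingNatBool.toLanguage {m : ℕ | Squarefree m} ∈ PPoly := by
  obtain ⟨f, hf, hfval⟩ := hA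
  obtain ⟨f', hf', hcanon, hjunk⟩ := stub_natAdapter f hf []
  obtain ⟨n₀, hdens⟩ := stub_densityNagell stub_sqfreeProductNagell stub_apSieve
  refine mem_PPoly_of_rurReduction (encodingNatBool.toLanguage {m : ℕ | Squarefree m})
    (encodingNatBool.toLanguage
      {d : ℕ | IsNegFundamentalDiscr d ∧ 3 ∣ BinaryQuadraticForm.classNumber (-(d : ℤ))})
    f' hf' (fun n => 4 * n + 8) (16 * Polynomial.X + 32) n₀ (fun n => ?_) ?_ ?_ hIQ
  · simp only [Polynomial.eval_add, Polynomial.eval_mul, Polynomial.eval_ofNat, Polynomial.eval_X]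
    omega
  · -- NO side (exact): non-squarefree numerals by `stub_oneSidedNagell`, non-numerals by the guard
    intro x hx r
    by_cases hcx : ∃ m : ℕ, encodeNat m = x
    · obtain ⟨m, rfl⟩ := hcx
      have hm : ¬ Squarefree m := fun h =>
        hx ((encodeNat_mem_toLanguage_iff {m : ℕ | Squarefree m} m).2 h)
      rw [hcanon, hfval, bitsToNat_encodeNat, encodeNat_mem_toLanguage_iff]
      rintro ⟨hfund, -⟩
      exact stub_oneSidedNagell ((m / Nat.gcd m 6)) (bitsToNat r) (sixFreeCore_bad hm) hfund
    · rw [hjunk x r (fun m hm => hcx ⟨m, hm⟩)]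
      exact nil_not_mem_iqThreeLanguage
  · -- YES side (density ≥ 1/4) on the core, and squarefree outputs are in `S`
    intro x hx hn
    obtain ⟨N, hN, hNx⟩ := hx
    change encodeNat N = x at hNx
    subst hNx
    have hsq : Squarefree N := hN
    obtain ⟨hGsq, hG2, hG3, hGpos⟩ := sixFreeCore_facts hsq
    have hNlt : N < 2 ^ (encodeNat N).length := by
      have h := bitsToNat_lt (encodeNat N)
      rwa [bitsToNat_encodeNat] at h
    have hGlt : (N / Nat.gcd N 6) < 2 ^ (encodeNat N).length :=
      lt_of_le_of_lt (Nat.div_le_self N _) hNlt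
    have h := hdens (encodeNat N).length hn ((N / Nat.gcd N 6)) hGsq hG2 hG3 hGpos hGlt
    have hq : 4 ≤ (16 * Polynomial.X + 32 : Polynomial ℕ).eval (encodeNat N).length := by
      simp only [Polynomial.eval_add, Polynomial.eval_mul, Polynomial.eval_ofNat, Polynomial.eval_X]
      omega
    refine h.trans ((Nat.mul_le_mul_right _ hq).trans (Nat.mul_le_mul_left _ ?_))
    rw [← card_filter_seeds_dec (4 * (encodeNat N).length + 8) (fun j => Squarefree
      ((N / Nat.gcd N 6) * (1 + 11 * (N / Nat.gcd N 6) + 11 * (N / Nat.gcd N 6) ^ 2 + 30 * (N / Nat.gcd N 6) * j) *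
        ((N / Nat.gcd N 6) * (1 + 11 * (N / Nat.gcd N 6) + 11 * (N / Nat.gcd N 6) ^ 2 + 30 * (N / Nat.gcd N 6) * j)
          + 8) *
        (4 * ((N / Nat.gcd N 6) * (1 + 11 * (N / Nat.gcd N 6) + 11 * (N / Nat.gcd N 6) ^ 2 +
          30 * (N / Nat.gcd N 6) * j)) + 27)))]
    refine Finset.card_le_card fun r hr => ?_
    rw [Finset.mem_filter] at hr ⊢
    refine ⟨Finset.mem_univ _, ?_⟩
    rw [hcanon, hfval, bitsToNat_encodeNat, encodeNat_mem_toLanguage_iff]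
    exact nagell_mem_of_squarefree ((N / Nat.gcd N 6)) _ hr.2

/-! ### The headline theorem (unconditional domination) -/

/-- **`IQ3 ∈ P/poly → SQUAREFREES ∈ P/poly`, UNCONDITIONALLY** (the sampler is realised in `FP` by
the landed `stub_samplerNagellFP`). -/
theorem toLanguage_squarefree_mem_PPoly_of_iqThree_nagell :
    encodingNatBool.toLanguage
      {d : ℕ | IsNegFundamentalDiscr d ∧ 3 ∣ BinaryQuadraticForm.classNumber (-(d : ℤ))} ∈ PPoly →
    encodingNatBool.toLanguage {m : ℕ | Squarefree m} ∈ PPoly :=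
  fun hIQ => toLanguage_squarefree_mem_PPoly_of_iqThree_of_sampler stub_samplerNagellFP hIQ

end Summit.QuantumAdvantage.QuantumAdvantage.Theorems.IqThreeNotPPoly

end
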